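import Literature.MathematicalPhysics.QuantumFieldTheory.Balaban1983to89.Beta.LogCloseRate

/-!
# `Balaban1983to89.Beta.MonotoneScales` — MONOTONICITY IN THE AVERAGING SCALE of Bałaban's U = 1 fibre
# objects: one more averaging step DECREASES the (1.62) alias sum `φ_μ` and the Landau-gauge covariance
# `QGQ*` (1.99), and INCREASES the fibre effective Laplacian `D_k` and the (1.66) form `⟨B, Δ_kB⟩` — in the
# Loewner order, with NO rate constant and NO floor; the lower bound of (1.67) holds with constant `1`

β-PERT ACCELERATION sub-cell, asymptotic lane asym1 (gen 6).  HONEST FRAMING (cell contract, verbatim):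
discharging `BetaPertH` makes Bałaban's UV stability UNCONDITIONAL — a real constructive-QFT result; it is
NOT the continuum limit and NOT the Clay problem.  THIS FILE is a structural fact about the printed U = 1
(`U(1)`, background field `1`) fibre objects of [B5] §1; it is NOT a wall binder (`D1Drift`, `CauchyRate S.β0`),
NOT `β̄_k → b₀ ln L`, and says nothing about the non-abelian parts of `β⁰_{k+1}` (B12 (1.22)).

## What is here (all `p′ ≠ 0` in the Brillouin zone; `N, R ≥ 1` numbers of averaging steps, `RN` the finer one)

Write `φ_μ^{(n)}` = `phi162 n μ` ((1.62) after `n` unit steps), `y^{(n)} = Δ₀φ^{(n)}` = `xIn n` (∈ `[γ₀,1]^d`,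
tree), `z^{(n)} = (Δ₀ + a y^{(n)})/(Δ₀ + a)` = `zIn n a`, `D^{(n)}(p′) = DeltaKfib n p′ = Δ₀·E(p′; y^{(n)})`
(`DeltaKfib_eq_Emat`), `QGQ*^{(n)} = qgq n a = a⁻¹(I − (Δ₀/(Δ₀+a))E(z^{(n)}))` (`qgq_eq_Emat`),
`⟨B,Δ^{(n)}B⟩ = formDk n M B` (third expression of (1.66) on the unit torus `T_M`).

* §1 THE SIGN OF ONE STEP.  `φ_μ^{(N)}(p′) − φ_μ^{(RN)}(p′) = Σ_l |u|²|v_μ|² N⁻² Δ₀(c_l)⁻¹·(1 − y_μ^{(R)}(c_l)) ≥ 0`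
  — the tree's COMPOSITION LAW `B5ActionRate166.phi162_mul` (the vector form of King's (4.5)) minus its `R = 1`
  instance `phi162_eq_sum_cAlias`, and the printed upper bound «Δ₀φ_μ ≤ γ₁ = 1» (`Delta0_phi162_le_one`) AT THE
  INNER LEVEL `R`.  Hence `φ^{(RN)} ≤ φ^{(N)}` (`phi162_refine_le`), `γ₀φ^{(N)} ≤ φ^{(RN)}` (`phi162_refine_ge`,
  from «γ₀ ≤ Δ₀φ»), and the sibling's two-sided rate `|φ^{(RN)} − φ^{(N)}| ≤ C_φN⁻²` (`phi162_rate`) becomes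
  ONE-SIDED: `0 ≤ φ^{(N)} − φ^{(RN)} ≤ C_φN⁻²` (`phi162_refine_bounds`).
* §2 THE BOX VARIABLES.  `y^{(RN)} ≤ y^{(N)}`, `z^{(RN)} ≤ z^{(N)}` componentwise; along divisibility `n ∣ n′`;
  FLOOR TRANSFER: a floor `y ≤ y_λ^{(n′)}` certified at ONE finer level `n′` (or for the infimum over all levels,
  §5) is a floor at every coarser level `n ∣ n′` — the two-level floor hypothesis `hfl` of
  `LogCloseRate.qform_DeltaKfib_relClose` reduces to its finer half.
* §3 LOEWNER ORDER.  `⟨w,D^{(N)}w⟩ ≤ ⟨w,D^{(RN)}w⟩` and `⟨w,(QGQ*)⁻¹_{(N)}w⟩ ≤ ⟨w,(QGQ*)⁻¹_{(RN)}w⟩`,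
  `⟨w,QGQ*^{(RN)}w⟩ ≤ ⟨w,QGQ*^{(N)}w⟩` for every `w ∈ ℂ^d` — by the sibling's one-line monotonicity of the matrix
  function `E` in its box variable (`LogCloseRate.qform_Emat_mono`, `r = 1`); NO matrix inversion.  With
  `LogCloseRate` (L): the SANDWICH `D^{(N)} ≤ D^{(RN)} ≤ (1 + Δ₀C_φN⁻²/y)·D^{(N)}` above ONE floor `y ≤ y^{(RN)}`.
* §4 THE FORMS.  `⟨B,Δ^{(N)}B⟩ ≤ ⟨B,Δ^{(RN)}B⟩` for every vector field `B` on every unit torus (`formDk_mono`, via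
  `B5QGQ199Rate.formDk_eq_sum_fibre`); at `n = 1` the weight (1.66) is `≡ 1` and `⟨B,Δ^{(1)}B⟩ = ⟨∂₁B,∂₁B⟩`
  (`formDk_one`); hence **the lower half of (1.67) with constant `1`**: `⟨∂₁B,∂₁B⟩ ≤ ⟨B,Δ^{(n)}B⟩` for all
  `n ≥ 1` (`d1Sq_le_formDk`; the tree's `ineq167` has `(4/π²)^{d+2}` there — the best POINTWISE bound of the weight,
  which the Bianchi-constrained `(∂₁B)~` beats); the one-sided `(1+t_N)³` sandwich and `0 ≤ log⟨B,Δ^{(RN)}B⟩ −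
  log⟨B,Δ^{(N)}B⟩ ≤ 3t_N`.  PRIOR ART IN THE TREE: for the GENUINE (1.65) operator `DelK` the lower constant `1` is
  `Beta.Ineq167Operator.ineq167_lower` (Federbush's stability of the averaging map; full (1.67) for `DelK` in
  `Beta.Ineq167OperatorUpper.ineq167_DelK`); the identity «form of `DelK` = `formDk`» ((1.65)↔(1.66)) is NOT
  certified in the tree, so `d1Sq_le_formDk` is the (1.66)-FORM-side counterpart by a different mechanism
  (monotonicity in the scale) — new for `formDk` only; the agreement of the two sharp constants is a consistency
  check on that dictionary, not a new bound for `DelK`.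
* §5 MONOTONE CONVERGENCE along `n = L^m`: `m ↦ ⟨B,Δ^{(L^m)}B⟩` is monotone and bounded, converges to its SUPREMUM,
  and every `⟨B,Δ^{(L^m)}B⟩` lies below the limit `F_∞(B)` of `B5ActionRate166.formDk_limit`; `m ↦ y^{(L^m)}` is
  antitone, converges to its INFIMUM `y_∞ ≥ γ₀`, and a floor for `y_∞` is a floor for every level.

## Sources.  [B5] = [Balaban1984PropagatorsI] T. Bałaban, Propagators and renormalization transformations for
lattice gauge theories. I, Comm. Math. Phys. 95 (1984) 17–40: (1.62) p. 28 with «0 < γ₀ ≤ Δ₀φ_μ ≤ γ₁», (1.65)–(1.67)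
p. 29, (1.99)–(1.100) p. 34 — print UNIFORM two-sided bounds only; no comparison of two values of `k` is printed
there or in [King1986] (C. King, *The U(1) Higgs model. I*, CMP 102 (1986) 649–677; composition law (4.5)–(4.6)
p. 670, (4.12) p. 671; v1.0.1 DOCSTRING-ONLY, v1 = p188130: «CMP 102/103» disambiguated — 103 is Part II;
ERRATUM E-asym1g10-2).  The abstract
principle — a shorted operator / Schur complement is antitone in the constraint — is classical (W. N. Anderson–
G. E. Trapp, shorted operators, SIAM J. Appl. Math. 28 (1975)); here everything is proved for the concrete printed
formulas from tree lemmas BY NAME.  Presearch (corpus fts+vec, galaxy): no statement of the monotonicity of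
Bałaban's `Δ_k` / King's `Δ^{(k)}` in `k` found.  Tags: [folklore] = elementary consequence of printed formulas,
not a printed statement; nothing here is cited as a published theorem.
-/

noncomputable section

namespace Literature.MathematicalPhysics.QuantumFieldTheory.Balaban1983to89.Beta.MonotoneScales

open scoped BigOperators ComplexConjugate Matrix Topology
open Finset Real Filter
open Literature.MathematicalPhysics.QuantumFieldTheory.Balaban1983to89.B4Strip
open Literature.MathematicalPhysics.QuantumFieldTheory.Balaban1983to89.B5Prop11Leaves
open Literature.MathematicalPhysics.QuantumFieldTheory.Balaban1983to89.B5Prop11Fiber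
open Literature.MathematicalPhysics.QuantumFieldTheory.Balaban1983to89.B5Prop11Plancherel
open Literature.MathematicalPhysics.QuantumFieldTheory.Balaban1983to89.B5Bounds167Lattice
open Literature.MathematicalPhysics.QuantumFieldTheory.Balaban1983to89.T4GaugeActionRate
open Literature.MathematicalPhysics.QuantumFieldTheory.Balaban1983to89.B5ActionRate166
open Literature.MathematicalPhysics.QuantumFieldTheory.Balaban1983to89.B5QGQ199Rate
open Literature.MathematicalPhysics.QuantumFieldTheory.Balaban1983to89.Beta.LogCloseRate

variable {d : ℕ}

/-! ## §1 The sign of one averaging step on the alias sum (1.62) -/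

section Phi

variable {N R : ℕ} [NeZero N] [NeZero R]

/-- at a nonzero zone momentum, `φ_μ^{(R)}(y) ≤ Δ₀(y)⁻¹` — the printed «Δ₀φ_μ ≤ γ₁», `γ₁ = 1`
(`Delta0_phi162_le_one`), divided by `Δ₀ > 0`. [folklore] -/
theorem phi162_le_inv_Delta1r (hR : 1 ≤ R) (μ : Fin d) (y : Fin d → ℝ) (hy : ∀ ν, |y ν| ≤ π)
    (ν₀ : Fin d) (hν₀ : y ν₀ ≠ 0) : phi162 R μ y ≤ (Delta1r 0 y)⁻¹ := by
  have hΔ := Delta1r_pos y hy ν₀ hν₀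
  have h1 := Delta0_phi162_le_one R hR μ y hy
  rw [le_inv_comm₀ (phi162_pos R hR y hy ν₀ hν₀ μ) hΔ]
  calc Delta1r 0 y = Delta1r 0 y * phi162 R μ y / phi162 R μ y := by
        field_simp [(phi162_pos R hR y hy ν₀ hν₀ μ).ne']
    _ ≤ 1 / phi162 R μ y := div_le_div_of_nonneg_right h1 (phi162_pos R hR y hy ν₀ hν₀ μ).le
    _ = (phi162 R μ y)⁻¹ := one_div _

/-- … and `γ₀·Δ₀(y)⁻¹ ≤ φ_μ^{(R)}(y)`, `γ₀ = (4/π²)^{d+2}` (`Delta0_phi162_lower`). [folklore] -/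
theorem gam0_mul_inv_Delta1r_le_phi162 (hR : 1 ≤ R) (μ : Fin d) (y : Fin d → ℝ) (hy : ∀ ν, |y ν| ≤ π)
    (ν₀ : Fin d) (hν₀ : y ν₀ ≠ 0) : gam0 d * (Delta1r 0 y)⁻¹ ≤ phi162 R μ y := by
  have hΔ := Delta1r_pos y hy ν₀ hν₀
  have h1 : gam0 d ≤ Delta1r 0 y * phi162 R μ y := Delta0_phi162_lower R hR μ y hy ν₀ hν₀
  rw [← div_eq_mul_inv, div_le_iff₀ hΔ, mul_comm]
  exact h1

omit [NeZero N] [NeZero R] in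
/-- the centred alias momentum `c_l = cAlias N l p′` of a nonzero zone momentum has a nonzero coordinate.
[folklore] -/
theorem exists_cAlias_ne_zero (hN : 1 ≤ N) (l : Fin d → Fin N) (s : Fin d → ℝ) (hs : ∀ ν, |s ν| ≤ π)
    (ν₀ : Fin d) (hν₀ : s ν₀ ≠ 0) : ∃ ν, cAlias N l s ν ≠ 0 :=
  exists_ne_zero_of_momSq_pos (cAlias_momSq_pos hN l hs (momSq_pos_of_ne s ν₀ hν₀))

/-- **ONE STEP, AS AN IDENTITY**: `φ_μ^{(N)}(p′) − φ_μ^{(RN)}(p′)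
= Σ_l |u^{(N)}|²|v_μ^{(N)}|²·N⁻²·(Δ₀(c_l)⁻¹ − φ_μ^{(R)}(c_l))` — the composition law `phi162_mul` minus its
`R = 1` instance `phi162_eq_sum_cAlias`. [folklore] -/
theorem phi162_sub_refine_eq (hN : 1 ≤ N) (hR : 1 ≤ R) (μ : Fin d) (s : Fin d → ℝ) (hs : ∀ ν, |s ν| ≤ π) :
    phi162 N μ s - phi162 (R * N) μ s = ∑ l : Fin d → Fin N,
      Ur N l s * uFactorr N (l μ : ℕ) (s μ) * ((N : ℝ) ^ 2)⁻¹
        * ((Delta1r 0 (cAlias N l s))⁻¹ - phi162 R μ (cAlias N l s)) := by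
  rw [phi162_mul hN hR μ s hs, phi162_eq_sum_cAlias hN μ s hs, ← Finset.sum_sub_distrib]
  exact Finset.sum_congr rfl fun l _ => by ring

/-- **AVERAGING DECREASES THE ALIAS SUM (1.62)**: for all `N, R ≥ 1`, every direction `μ` and every `p′ ≠ 0` in
the Brillouin zone, `φ_μ^{(RN)}(p′) ≤ φ_μ^{(N)}(p′)`. [folklore] -/
theorem phi162_refine_le (hN : 1 ≤ N) (hR : 1 ≤ R) (μ : Fin d) (s : Fin d → ℝ) (hs : ∀ ν, |s ν| ≤ π)
    (ν₀ : Fin d) (hν₀ : s ν₀ ≠ 0) : phi162 (R * N) μ s ≤ phi162 N μ s := by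
  rw [← sub_nonneg, phi162_sub_refine_eq hN hR μ s hs]
  refine Finset.sum_nonneg fun l _ => ?_
  obtain ⟨ν₁, hν₁⟩ := exists_cAlias_ne_zero hN l s hs ν₀ hν₀
  have hc := abs_cAlias_le hN l s hs
  have h1 : 0 ≤ (Delta1r 0 (cAlias N l s))⁻¹ - phi162 R μ (cAlias N l s) :=
    sub_nonneg.mpr (phi162_le_inv_Delta1r hR μ _ hc ν₁ hν₁)
  have h2 := Ur_nonneg N l s
  have h3 := uFactorr_nonneg N (l μ : ℕ) (s μ)
  positivity

/-- **… BY AT MOST THE FACTOR `γ₀`**: `γ₀·φ_μ^{(N)}(p′) ≤ φ_μ^{(RN)}(p′)`, `γ₀ = (4/π²)^{d+2}`. [folklore] -/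
theorem phi162_refine_ge (hN : 1 ≤ N) (hR : 1 ≤ R) (μ : Fin d) (s : Fin d → ℝ) (hs : ∀ ν, |s ν| ≤ π)
    (ν₀ : Fin d) (hν₀ : s ν₀ ≠ 0) : gam0 d * phi162 N μ s ≤ phi162 (R * N) μ s := by
  rw [phi162_mul hN hR μ s hs, phi162_eq_sum_cAlias hN μ s hs, Finset.mul_sum]
  refine Finset.sum_le_sum fun l _ => ?_
  obtain ⟨ν₁, hν₁⟩ := exists_cAlias_ne_zero hN l s hs ν₀ hν₀
  have hc := abs_cAlias_le hN l s hs
  have h1 := gam0_mul_inv_Delta1r_le_phi162 hR μ _ hc ν₁ hν₁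
  have h2 := Ur_nonneg N l s
  have h3 := uFactorr_nonneg N (l μ : ℕ) (s μ)
  have h4 : 0 ≤ Ur N l s * uFactorr N (l μ : ℕ) (s μ) * ((N : ℝ) ^ 2)⁻¹ := by positivity
  calc gam0 d * (Ur N l s * uFactorr N (l μ : ℕ) (s μ) * ((N : ℝ) ^ 2)⁻¹ * (Delta1r 0 (cAlias N l s))⁻¹)
      = Ur N l s * uFactorr N (l μ : ℕ) (s μ) * ((N : ℝ) ^ 2)⁻¹ * (gam0 d * (Delta1r 0 (cAlias N l s))⁻¹) := by
        ring
    _ ≤ Ur N l s * uFactorr N (l μ : ℕ) (s μ) * ((N : ℝ) ^ 2)⁻¹ * phi162 R μ (cAlias N l s) :=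
        mul_le_mul_of_nonneg_left h1 h4

/-- **THE ONE-SIDED RATE**: `0 ≤ φ_μ^{(N)}(p′) − φ_μ^{(RN)}(p′) ≤ C_φ·N⁻²`, `C_φ = π²/12 + 1/3` — the sibling's
two-sided `phi162_rate` with its sign decided. [folklore] -/
theorem phi162_refine_bounds (hN : 1 ≤ N) (hR : 1 ≤ R) (μ : Fin d) (s : Fin d → ℝ) (hs : ∀ ν, |s ν| ≤ π)
    (ν₀ : Fin d) (hν₀ : s ν₀ ≠ 0) :
    0 ≤ phi162 N μ s - phi162 (R * N) μ s ∧ phi162 N μ s - phi162 (R * N) μ s ≤ Cphi * ((N : ℝ) ^ 2)⁻¹ := by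
  refine ⟨sub_nonneg.mpr (phi162_refine_le hN hR μ s hs ν₀ hν₀), ?_⟩
  have h := phi162_rate hN hR μ s hs ν₀ hν₀
  rw [abs_sub_comm] at h
  exact le_trans (le_abs_self _) h

/-- the relative form: `φ_μ^{(RN)} ≤ φ_μ^{(N)} ≤ γ₀⁻¹·φ_μ^{(RN)}`. [folklore] -/
theorem phi162_le_inv_gam0_mul_refine (hN : 1 ≤ N) (hR : 1 ≤ R) (μ : Fin d) (s : Fin d → ℝ)
    (hs : ∀ ν, |s ν| ≤ π) (ν₀ : Fin d) (hν₀ : s ν₀ ≠ 0) :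
    phi162 N μ s ≤ (gam0 d)⁻¹ * phi162 (R * N) μ s := by
  have hγ := gam0_pos d
  have h := phi162_refine_ge hN hR μ s hs ν₀ hν₀
  calc phi162 N μ s = (gam0 d)⁻¹ * (gam0 d * phi162 N μ s) := by field_simp
    _ ≤ (gam0 d)⁻¹ * phi162 (R * N) μ s := mul_le_mul_of_nonneg_left h (inv_nonneg.mpr hγ.le)

end Phi

/-! ## §2 The box variables `y = Δ₀φ^{(1.62)}` and `z`, and the transfer of floors -/

section Box

variable {N R : ℕ} [NeZero N] [NeZero R]

/-- **`y^{(RN)} ≤ y^{(N)}` componentwise** (`y = xIn = Δ₀φ^{(1.62)}`). [folklore] -/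
theorem xIn_refine_le (hN : 1 ≤ N) (hR : 1 ≤ R) (s : Fin d → ℝ) (hs : ∀ ν, |s ν| ≤ π) (ν₀ : Fin d)
    (hν₀ : s ν₀ ≠ 0) (κ : Fin d) : xIn (R * N) s κ ≤ xIn N s κ := by
  unfold xIn
  exact mul_le_mul_of_nonneg_left (phi162_refine_le hN hR κ s hs ν₀ hν₀) (Delta1r_pos s hs ν₀ hν₀).le

/-- `γ₀·y^{(N)} ≤ y^{(RN)}` componentwise. [folklore] -/
theorem gam0_mul_xIn_le_refine (hN : 1 ≤ N) (hR : 1 ≤ R) (s : Fin d → ℝ) (hs : ∀ ν, |s ν| ≤ π) (ν₀ : Fin d)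
    (hν₀ : s ν₀ ≠ 0) (κ : Fin d) : gam0 d * xIn N s κ ≤ xIn (R * N) s κ := by
  unfold xIn
  have h := phi162_refine_ge hN hR κ s hs ν₀ hν₀
  have hΔ := (Delta1r_pos s hs ν₀ hν₀).le
  calc gam0 d * (Delta1r 0 s * phi162 N κ s) = Delta1r 0 s * (gam0 d * phi162 N κ s) := by ring
    _ ≤ Delta1r 0 s * phi162 (R * N) κ s := mul_le_mul_of_nonneg_left h hΔ

/-- **`z^{(RN)} ≤ z^{(N)}` componentwise** for `a ≥ 0` (`z = (Δ₀ + a y)/(Δ₀ + a)` is increasing in `y`). [folklore] -/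
theorem zIn_refine_le (hN : 1 ≤ N) (hR : 1 ≤ R) (a : ℝ) (ha : 0 ≤ a) (s : Fin d → ℝ) (hs : ∀ ν, |s ν| ≤ π)
    (ν₀ : Fin d) (hν₀ : s ν₀ ≠ 0) (κ : Fin d) : zIn (R * N) a s κ ≤ zIn N a s κ := by
  unfold zIn
  have hΔ := Delta1r_pos s hs ν₀ hν₀
  have h := xIn_refine_le hN hR s hs ν₀ hν₀ κ
  refine div_le_div_of_nonneg_right ?_ (by linarith)
  nlinarith [mul_le_mul_of_nonneg_left h ha]

/-- along DIVISIBILITY: `n ∣ n′ ⇒ y^{(n′)} ≤ y^{(n)}` componentwise. [folklore] -/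
theorem xIn_anti_of_dvd {n n' : ℕ} [NeZero n] [NeZero n'] (h : n ∣ n') (s : Fin d → ℝ) (hs : ∀ ν, |s ν| ≤ π)
    (ν₀ : Fin d) (hν₀ : s ν₀ ≠ 0) (κ : Fin d) : xIn n' s κ ≤ xIn n s κ := by
  obtain ⟨R, hR⟩ := h
  have hn : 1 ≤ n := Nat.one_le_iff_ne_zero.mpr (NeZero.ne n)
  have hR0 : R ≠ 0 := by
    intro h0; rw [h0, mul_zero] at hR; exact NeZero.ne n' hR
  haveI : NeZero R := ⟨hR0⟩
  have hR1 : 1 ≤ R := Nat.one_le_iff_ne_zero.mpr hR0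
  rw [hR, mul_comm]
  exact xIn_refine_le hn hR1 s hs ν₀ hν₀ κ

/-- along divisibility for (1.62) itself: `n ∣ n′ ⇒ φ_μ^{(n′)} ≤ φ_μ^{(n)}`. [folklore] -/
theorem phi162_anti_of_dvd {n n' : ℕ} [NeZero n] [NeZero n'] (h : n ∣ n') (μ : Fin d) (s : Fin d → ℝ)
    (hs : ∀ ν, |s ν| ≤ π) (ν₀ : Fin d) (hν₀ : s ν₀ ≠ 0) : phi162 n' μ s ≤ phi162 n μ s := by
  have hΔ := Delta1r_pos s hs ν₀ hν₀
  have h1 := xIn_anti_of_dvd h s hs ν₀ hν₀ μ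
  unfold xIn at h1
  exact le_of_mul_le_mul_left h1 hΔ

/-- **FLOOR TRANSFER**: a floor certified at the FINER level serves the coarser one —
`y ≤ y_λ^{(RN)} ⇒ y ≤ y_λ^{(N)}`; in particular the two-level floor hypothesis of
`LogCloseRate.qform_DeltaKfib_relClose` is implied by its finer half. [folklore] -/
theorem floor_transfer (hN : 1 ≤ N) (hR : 1 ≤ R) (s : Fin d → ℝ) (hs : ∀ ν, |s ν| ≤ π) (ν₀ : Fin d)
    (hν₀ : s ν₀ ≠ 0) {y : ℝ} (hfl : ∀ κ, y ≤ xIn (R * N) s κ) (κ : Fin d) :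
    y ≤ xIn N s κ ∧ y ≤ xIn (R * N) s κ :=
  ⟨le_trans (hfl κ) (xIn_refine_le hN hR s hs ν₀ hν₀ κ), hfl κ⟩

end Box

/-! ## §3 The Loewner order: `D_k` and `(QGQ*)⁻¹` increase, `QGQ*` decreases -/

section Loewner

variable {N R : ℕ} [NeZero N] [NeZero R]

/-- **THE FIBRE EFFECTIVE LAPLACIAN INCREASES UNDER AVERAGING**: for all `N, R ≥ 1`, `p′ ≠ 0` in the zone and
every `w ∈ ℂ^d`, `⟨w, D^{(N)}(p′)w⟩ ≤ ⟨w, D^{(RN)}(p′)w⟩` (`D = DeltaKfib = Δ₀·E(y)`, `E` operator-decreasing in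
`y`, `y^{(RN)} ≤ y^{(N)}`). [folklore] -/
theorem qform_DeltaKfib_mono (hN : 1 ≤ N) (hR : 1 ≤ R) (s : Fin d → ℝ) (hs : ∀ κ, |s κ| ≤ π) (ν₀ : Fin d)
    (hν₀ : s ν₀ ≠ 0) (w : Fin d → ℂ) :
    (qform (DeltaKfib N s) w).re ≤ (qform (DeltaKfib (R * N) s) w).re := by
  haveI : NeZero (R * N) := ⟨Nat.mul_ne_zero (NeZero.ne R) (NeZero.ne N)⟩
  have hRN : 1 ≤ R * N := Nat.one_le_iff_ne_zero.mpr (NeZero.ne (R * N))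
  have hΔ := Delta1r_pos s hs ν₀ hν₀
  have hx : ∀ κ, 0 < xIn N s κ := fun κ => lt_of_lt_of_le (gam0_pos d) (xIn_mem_box N hN s hs ν₀ hν₀ κ).1
  have hx' : ∀ κ, 0 < xIn (R * N) s κ :=
    fun κ => lt_of_lt_of_le (gam0_pos d) (xIn_mem_box (R * N) hRN s hs ν₀ hν₀ κ).1
  have hcmp : ∀ κ, xIn (R * N) s κ ≤ 1 * xIn N s κ := fun κ => by
    rw [one_mul]; exact xIn_refine_le hN hR s hs ν₀ hν₀ κ
  have h := qform_Emat_mono s (xIn N s) (xIn (R * N) s) w hx hx' hcmp hΔ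
  rw [one_mul] at h
  rw [DeltaKfib_eq_Emat N hN s hs ν₀ hν₀, DeltaKfib_eq_Emat (R * N) hRN s hs ν₀ hν₀, qform_smul, qform_smul,
    Complex.re_ofReal_mul, Complex.re_ofReal_mul]
  exact mul_le_mul_of_nonneg_left h hΔ.le

/-- **THE SANDWICH ABOVE ONE FLOOR**: with a floor `0 < y ≤ y_λ^{(RN)}(p′)` at the FINER level only and
`t := Δ₀(p′)·C_φ·N⁻²/y`: `⟨w,D^{(N)}w⟩ ≤ ⟨w,D^{(RN)}w⟩ ≤ (1+t)·⟨w,D^{(N)}w⟩` — `LogCloseRate` (L) with its lower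
tolerance replaced by `0`. [folklore] -/
theorem qform_DeltaKfib_sandwich (hN : 1 ≤ N) (hR : 1 ≤ R) (s : Fin d → ℝ) (hs : ∀ κ, |s κ| ≤ π) (ν₀ : Fin d)
    (hν₀ : s ν₀ ≠ 0) {y : ℝ} (hy : 0 < y) (hfl : ∀ κ, y ≤ xIn (R * N) s κ) (w : Fin d → ℂ) :
    (qform (DeltaKfib N s) w).re ≤ (qform (DeltaKfib (R * N) s) w).re
      ∧ (qform (DeltaKfib (R * N) s) w).re
        ≤ (1 + Delta1r 0 s * (Cphi * ((N : ℝ) ^ 2)⁻¹) / y) * (qform (DeltaKfib N s) w).re :=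
  ⟨qform_DeltaKfib_mono hN hR s hs ν₀ hν₀ w,
    (qform_DeltaKfib_relClose hN hR s hs ν₀ hν₀ hy (floor_transfer hN hR s hs ν₀ hν₀ hfl) w).2⟩

/-- the tree-floor instance of the sandwich (`y = γ₀`, no hypothesis): `⟨w,D^{(N)}w⟩ ≤ ⟨w,D^{(RN)}w⟩ ≤
(1 + 4d·C_φ·γ₀⁻¹·N⁻²)·⟨w,D^{(N)}w⟩`. [folklore] -/
theorem qform_DeltaKfib_sandwich_gam0 (hN : 1 ≤ N) (hR : 1 ≤ R) (s : Fin d → ℝ) (hs : ∀ κ, |s κ| ≤ π)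
    (ν₀ : Fin d) (hν₀ : s ν₀ ≠ 0) (w : Fin d → ℂ) :
    (qform (DeltaKfib N s) w).re ≤ (qform (DeltaKfib (R * N) s) w).re
      ∧ (qform (DeltaKfib (R * N) s) w).re
        ≤ (1 + 4 * d * Cphi / gam0 d * ((N : ℝ) ^ 2)⁻¹) * (qform (DeltaKfib N s) w).re :=
  ⟨qform_DeltaKfib_mono hN hR s hs ν₀ hν₀ w, (qform_DeltaKfib_relClose_gam0 hN hR s hs ν₀ hν₀ w).2⟩

/-- **`(QGQ*)⁻¹ = a·I + D_k` INCREASES UNDER AVERAGING** (any real `a`; the common part cancels). [folklore] -/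
theorem qform_qgqInv_mono (hN : 1 ≤ N) (hR : 1 ≤ R) (a : ℝ) (s : Fin d → ℝ) (hs : ∀ κ, |s κ| ≤ π)
    (ν₀ : Fin d) (hν₀ : s ν₀ ≠ 0) (w : Fin d → ℂ) :
    (qform (qgqInv N a s) w).re ≤ (qform (qgqInv (R * N) a s) w).re := by
  have h := qform_DeltaKfib_mono hN hR s hs ν₀ hν₀ w
  have e : ∀ n : ℕ, (qform (qgqInv n a s) w).re = a * (∑ μ, ‖w μ‖ ^ 2) + (qform (DeltaKfib n s) w).re := by
    intro n
    unfold qgqInv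
    rw [qform_add, qform_smul, qform_one, Complex.add_re, ← Complex.ofReal_mul, Complex.ofReal_re]
  rw [e N, e (R * N)]
  linarith

/-- **THE LANDAU-GAUGE COVARIANCE `QGQ*` (1.99) DECREASES UNDER AVERAGING**: for `a ≥ 0`, `p′ ≠ 0` and every
`w ∈ ℂ^d`, `⟨w, QGQ*^{(RN)}(p′)w⟩ ≤ ⟨w, QGQ*^{(N)}(p′)w⟩` — `QGQ* = a⁻¹(I − (Δ₀/(Δ₀+a))·E(z))` (`qgq_eq_Emat`) with
`E` decreasing in `z` and `z^{(RN)} ≤ z^{(N)}`; no matrix inversion is used. [folklore] -/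
theorem qform_qgq_anti (hN : 1 ≤ N) (hR : 1 ≤ R) (a : ℝ) (ha : 0 ≤ a) (s : Fin d → ℝ) (hs : ∀ κ, |s κ| ≤ π)
    (ν₀ : Fin d) (hν₀ : s ν₀ ≠ 0) (w : Fin d → ℂ) :
    (qform (qgq (R * N) a s) w).re ≤ (qform (qgq N a s) w).re := by
  haveI : NeZero (R * N) := ⟨Nat.mul_ne_zero (NeZero.ne R) (NeZero.ne N)⟩
  have hRN : 1 ≤ R * N := Nat.one_le_iff_ne_zero.mpr (NeZero.ne (R * N))
  have hΔ := Delta1r_pos s hs ν₀ hν₀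
  have hz : ∀ κ, 0 < zIn N a s κ :=
    fun κ => lt_of_lt_of_le (gam0_pos d) (zIn_mem_box N hN a ha s hs ν₀ hν₀ κ).1
  have hz' : ∀ κ, 0 < zIn (R * N) a s κ :=
    fun κ => lt_of_lt_of_le (gam0_pos d) (zIn_mem_box (R * N) hRN a ha s hs ν₀ hν₀ κ).1
  have hcmp : ∀ κ, zIn (R * N) a s κ ≤ 1 * zIn N a s κ := fun κ => by
    rw [one_mul]; exact zIn_refine_le hN hR a ha s hs ν₀ hν₀ κ
  have h := qform_Emat_mono s (zIn N a s) (zIn (R * N) a s) w hz hz' hcmp hΔ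
  rw [one_mul] at h
  rw [(qform_qgq_re N hN a ha s hs ν₀ hν₀ w).1, (qform_qgq_re (R * N) hRN a ha s hs ν₀ hν₀ w).1]
  have hc : 0 ≤ Delta1r 0 s / (Delta1r 0 s + a) := div_nonneg hΔ.le (by linarith)
  have hai : 0 ≤ a⁻¹ := inv_nonneg.mpr ha
  exact mul_le_mul_of_nonneg_left (by nlinarith [mul_le_mul_of_nonneg_left h hc]) hai

/-- the two printed halves of (1.100) AND the new comparison in one line: for `a > 0`,
`a⁻¹Σ(1 − φ_μ⁻¹)|w_μ|² ≤ ⟨w,QGQ*^{(RN)}w⟩ ≤ ⟨w,QGQ*^{(N)}w⟩ ≤ a⁻¹Σ|w_μ|²` (`φ_μ` = `phiMu (R N) a`, (1.84)).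
[folklore] -/
theorem qform_qgq_chain (hN : 1 ≤ N) (hR : 1 ≤ R) (a : ℝ) (ha : 0 < a) (s : Fin d → ℝ) (hs : ∀ κ, |s κ| ≤ π)
    (ν₀ : Fin d) (hν₀ : s ν₀ ≠ 0) (w : Fin d → ℂ) :
    a⁻¹ * ∑ μ, (1 - 1 / phiMu (R * N) a μ s) * ‖w μ‖ ^ 2 ≤ (qform (qgq (R * N) a s) w).re
      ∧ (qform (qgq (R * N) a s) w).re ≤ (qform (qgq N a s) w).re
      ∧ (qform (qgq N a s) w).re ≤ a⁻¹ * ∑ μ, ‖w μ‖ ^ 2 := by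
  haveI : NeZero (R * N) := ⟨Nat.mul_ne_zero (NeZero.ne R) (NeZero.ne N)⟩
  have hRN : 1 ≤ R * N := Nat.one_le_iff_ne_zero.mpr (NeZero.ne (R * N))
  exact ⟨ineq1100_lower (R * N) hRN a ha s hs ν₀ hν₀ w, qform_qgq_anti hN hR a ha.le s hs ν₀ hν₀ w,
    ineq1100_upper N hN a ha s hs ν₀ hν₀ w⟩

end Loewner

/-! ## §4 The (1.66) forms on the unit torus: monotone in the scale; (1.67) with lower constant `1` -/

section Form

variable (M : Fin d → ℕ) [hM : ∀ μ, NeZero (M μ)]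
variable {N R : ℕ} [NeZero N] [NeZero R]

/-- **THE U(1) EFFECTIVE ACTION INCREASES UNDER AVERAGING**: for every unit torus `T_M`, every vector field `B`
and all `N, R ≥ 1`, `⟨B, Δ^{(N)}B⟩ ≤ ⟨B, Δ^{(RN)}B⟩` (forms (1.66) = `formDk`; fibrewise by §3 through
`formDk_eq_sum_fibre`). [folklore] -/
theorem formDk_mono (hN : 1 ≤ N) (hR : 1 ≤ R) (B : Tor M × Fin d → ℂ) :
    formDk N M B ≤ formDk (R * N) M B := by
  haveI : NeZero (R * N) := ⟨Nat.mul_ne_zero (NeZero.ne R) (NeZero.ne N)⟩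
  have hRN : 1 ≤ R * N := Nat.one_le_iff_ne_zero.mpr (NeZero.ne (R * N))
  rw [formDk_eq_sum_fibre N M hN B, formDk_eq_sum_fibre (R * N) M hRN B]
  refine Finset.sum_le_sum fun p _ => ?_
  by_cases hp : sOf M p = 0
  · rw [if_pos hp, if_pos hp]
  · rw [if_neg hp, if_neg hp]
    obtain ⟨ν₀, hν₀⟩ := Function.ne_iff.mp hp
    exact qform_DeltaKfib_mono hN hR (sOf M p) (abs_sOf_le M p) ν₀ hν₀ _

/-- along divisibility: `n ∣ n′ ⇒ ⟨B,Δ^{(n)}B⟩ ≤ ⟨B,Δ^{(n′)}B⟩`. [folklore] -/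
theorem formDk_mono_of_dvd {n n' : ℕ} [NeZero n] [NeZero n'] (h : n ∣ n') (B : Tor M × Fin d → ℂ) :
    formDk n M B ≤ formDk n' M B := by
  obtain ⟨R, hR⟩ := h
  have hn : 1 ≤ n := Nat.one_le_iff_ne_zero.mpr (NeZero.ne n)
  have hR0 : R ≠ 0 := by
    intro h0; rw [h0, mul_zero] at hR; exact NeZero.ne n' hR
  haveI : NeZero R := ⟨hR0⟩
  have hR1 : 1 ≤ R := Nat.one_le_iff_ne_zero.mpr hR0
  rw [hR, mul_comm]
  exact formDk_mono M hn hR1 B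

/-- at `n = 1` (no averaging) the weight (1.66) is identically `1` on the punctured zone
(`φ_λ^{(1)} = Δ₀⁻¹`, `Σ_λ|∂¹_λ|² = Δ₀`). [folklore] -/
theorem w166_one (μ ν : Fin d) (s : Fin d → ℝ) (hs : ∀ κ, |s κ| ≤ π) (ν₀ : Fin d) (hν₀ : s ν₀ ≠ 0) :
    w166 1 μ ν s = 1 := by
  have hΔ := Delta1r_pos s hs ν₀ hν₀
  have hφ : ∀ κ, phi162 1 κ s = (Delta1r 0 s)⁻¹ := fun κ => phi162_one κ s hs
  unfold w166
  simp only [hφ]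
  have hsum : ∑ κ : Fin d, ‖d1Sym s κ‖ ^ 2 / (Delta1r 0 s ^ 2 * (Delta1r 0 s)⁻¹) = 1 := by
    have e : ∀ κ : Fin d, ‖d1Sym s κ‖ ^ 2 / (Delta1r 0 s ^ 2 * (Delta1r 0 s)⁻¹) = S1r (s κ) / Delta1r 0 s := by
      intro κ; rw [norm_d1Sym_sq]; field_simp
    simp only [e]
    rw [← Finset.sum_div, div_eq_one_iff_eq hΔ.ne']
    unfold Delta1r; simp
  rw [hsum]
  field_simp

/-- **`⟨B, Δ^{(1)}B⟩ = ⟨∂₁B, ∂₁B⟩`**: with no averaging step the (1.66) form is the bare quadratic form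
(Plancherel, `d1Sq_eq_sum_hat`). [folklore] -/
theorem formDk_one (B : Tor M × Fin d → ℂ) : formDk 1 M B = d1Sq M B := by
  rw [d1Sq_eq_sum_hat]
  unfold formDk
  congr 1
  refine Finset.sum_congr rfl fun μ _ => Finset.sum_congr rfl fun ν _ => Finset.sum_congr rfl fun p _ => ?_
  by_cases hp : sOf M p = 0
  · rw [curlHat_eq_zero_of M B μ ν p hp, norm_zero]; simp
  · obtain ⟨ν₀, hν₀⟩ := Function.ne_iff.mp hp
    rw [w166_one μ ν (sOf M p) (abs_sOf_le M p) ν₀ hν₀, one_mul]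

/-- **THE LOWER HALF OF (1.67) WITH CONSTANT `1`** (for the (1.66) form `formDk`): for every `n = L^k ≥ 1`, every
unit torus and every vector field `B`, `⟨∂₁B, ∂₁B⟩ ≤ ⟨B, Δ^{(n)}B⟩` — the tree's `ineq167` has `(4/π²)^{d+2}` in
this place; for the genuine (1.65) operator `DelK` the constant `1` is `Beta.Ineq167Operator.ineq167_lower`
(different object, different mechanism; the (1.65)↔(1.66) identity is not certified in the tree). [folklore] -/
theorem d1Sq_le_formDk (n : ℕ) [NeZero n] (hn : 1 ≤ n) (B : Tor M × Fin d → ℂ) : d1Sq M B ≤ formDk n M B := by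
  rw [← formDk_one M B]
  have h := formDk_mono M (N := 1) (R := n) le_rfl hn B
  rw [mul_one] at h
  exact h

/-- (1.67) on the unit torus with the constants `1` and `(π²/4)^{2d+4}`:
`⟨∂₁B,∂₁B⟩ ≤ ⟨B,Δ^{(n)}B⟩ ≤ (π²/4)^{2d+4}·⟨∂₁B,∂₁B⟩`. [folklore] -/
theorem ineq167_sharp_lower (n : ℕ) [NeZero n] (hn : 1 ≤ n) (B : Tor M × Fin d → ℂ) :
    d1Sq M B ≤ formDk n M B ∧ formDk n M B ≤ (Real.pi ^ 2 / 4) ^ (2 * d + 4) * d1Sq M B :=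
  ⟨d1Sq_le_formDk M n hn B, (ineq167 n M hn B).2⟩

/-- **THE ONE-SIDED `(1+t_N)³` SANDWICH OF THE FORMS**, `t_N = 4d·C_φ·γ₀⁻¹·N⁻²`:
`⟨B,Δ^{(N)}B⟩ ≤ ⟨B,Δ^{(RN)}B⟩ ≤ (1+t_N)³·⟨B,Δ^{(N)}B⟩` (`LogCloseRate.formDk_relClose`, lower tolerance `0`).
[folklore] -/
theorem formDk_sandwich (hN : 1 ≤ N) (hR : 1 ≤ R) (B : Tor M × Fin d → ℂ) :
    formDk N M B ≤ formDk (R * N) M B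
      ∧ formDk (R * N) M B ≤ (1 + 4 * d * Cphi / gam0 d * ((N : ℝ) ^ 2)⁻¹) ^ 3 * formDk N M B :=
  ⟨formDk_mono M hN hR B, (formDk_relClose M hN hR B).2⟩

/-- log form: `0 ≤ log⟨B,Δ^{(RN)}B⟩ − log⟨B,Δ^{(N)}B⟩ ≤ 3·log(1+t_N)` (for `⟨B,Δ^{(N)}B⟩ = 0` both forms vanish and
Lean's `log 0 = 0` keeps both inequalities). [folklore] -/
theorem log_formDk_sub_bounds (hN : 1 ≤ N) (hR : 1 ≤ R) (B : Tor M × Fin d → ℂ) :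
    0 ≤ Real.log (formDk (R * N) M B) - Real.log (formDk N M B)
      ∧ Real.log (formDk (R * N) M B) - Real.log (formDk N M B)
        ≤ 3 * Real.log (1 + 4 * d * Cphi / gam0 d * ((N : ℝ) ^ 2)⁻¹) := by
  haveI : NeZero (R * N) := ⟨Nat.mul_ne_zero (NeZero.ne R) (NeZero.ne N)⟩
  have hRN : 1 ≤ R * N := Nat.one_le_iff_ne_zero.mpr (NeZero.ne (R * N))
  obtain ⟨h1, h2⟩ := formDk_sandwich M hN hR B
  have f0 := formDk_nonneg M N hN B
  have hlog := (abs_log_formDk_sub_le M hN hR B).1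
  refine ⟨?_, ?_⟩
  · rcases f0.eq_or_lt with hz | hpos
    · -- `⟨B,Δ^{(N)}B⟩ = 0` forces `⟨B,Δ^{(RN)}B⟩ = 0` by the upper half of the sandwich
      have hz' : formDk (R * N) M B = 0 := by
        have : formDk (R * N) M B ≤ 0 := by rw [← hz, mul_zero] at h2; exact h2
        exact le_antisymm this (formDk_nonneg M (R * N) hRN B)
      rw [← hz, hz']; simp
    · exact sub_nonneg.mpr (Real.log_le_log hpos h1)
  · rw [abs_sub_comm] at hlog
    exact le_trans (le_abs_self _) hlog

end Form

/-! ## §5 Monotone convergence along `n = L^m` -/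

section Limit

variable (M : Fin d → ℕ) [hM : ∀ μ, NeZero (M μ)]

/-- **`m ↦ ⟨B, Δ^{(L^m)}B⟩` IS MONOTONE** (`L ≥ 1`). [folklore] -/
theorem formDk_pow_monotone (L : ℕ) (hL : 1 ≤ L) (B : Tor M × Fin d → ℂ) :
    Monotone (fun m => formDk (L ^ m) M B) := by
  refine monotone_nat_of_le_succ fun m => ?_
  haveI : NeZero (L ^ m) := ⟨pow_ne_zero m (Nat.one_le_iff_ne_zero.mp hL)⟩
  haveI : NeZero L := ⟨by omega⟩
  have h := formDk_mono M (N := L ^ m) (R := L) (Nat.one_le_iff_ne_zero.mpr (pow_ne_zero m (Nat.one_le_iff_ne_zero.mp hL))) hL B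
  simpa [pow_succ, mul_comm] using h

/-- **`m ↦ y_λ^{(L^m)}(p′)` IS ANTITONE** (`L ≥ 1`, `p′ ≠ 0`). [folklore] -/
theorem xIn_pow_antitone (L : ℕ) (hL : 1 ≤ L) (s : Fin d → ℝ) (hs : ∀ ν, |s ν| ≤ π) (ν₀ : Fin d)
    (hν₀ : s ν₀ ≠ 0) (κ : Fin d) : Antitone (fun m => xIn (L ^ m) s κ) := by
  refine antitone_nat_of_succ_le fun m => ?_
  haveI : NeZero (L ^ m) := ⟨pow_ne_zero m (Nat.one_le_iff_ne_zero.mp hL)⟩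
  haveI : NeZero L := ⟨by omega⟩
  have h := xIn_refine_le (N := L ^ m) (R := L) (Nat.one_le_iff_ne_zero.mpr (pow_ne_zero m (Nat.one_le_iff_ne_zero.mp hL))) hL
    s hs ν₀ hν₀ κ
  simpa [pow_succ, mul_comm] using h

/-- **MONOTONE CONVERGENCE OF THE U(1) EFFECTIVE ACTIONS TO THEIR SUPREMUM**: for `L ≥ 1` and every `B`, the
sequence `⟨B,Δ^{(L^m)}B⟩` is bounded by `(π²/4)^{2d+4}⟨∂₁B,∂₁B⟩`, converges to `sup_m ⟨B,Δ^{(L^m)}B⟩`, and every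
term lies below that supremum. [folklore] -/
theorem formDk_tendsto_iSup (L : ℕ) (hL : 1 ≤ L) (B : Tor M × Fin d → ℂ) :
    Tendsto (fun m => formDk (L ^ m) M B) atTop (𝓝 (⨆ m, formDk (L ^ m) M B))
      ∧ ∀ m, formDk (L ^ m) M B ≤ ⨆ m, formDk (L ^ m) M B := by
  have hbdd : BddAbove (Set.range fun m => formDk (L ^ m) M B) := by
    refine ⟨(Real.pi ^ 2 / 4) ^ (2 * d + 4) * d1Sq M B, ?_⟩
    rintro _ ⟨m, rfl⟩
    haveI : NeZero (L ^ m) := ⟨pow_ne_zero m (Nat.one_le_iff_ne_zero.mp hL)⟩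
    exact (ineq167 (L ^ m) M (Nat.one_le_iff_ne_zero.mpr (pow_ne_zero m (Nat.one_le_iff_ne_zero.mp hL))) B).2
  exact ⟨tendsto_atTop_ciSup (formDk_pow_monotone M L hL B) hbdd, fun m => le_ciSup hbdd m⟩

/-- **EVERY `⟨B,Δ_kB⟩` LIES BELOW THE LIMIT `F_∞(B)`** of `B5ActionRate166.formDk_limit` (`L ≥ 2`), and
`0 ≤ F_∞(B) − ⟨B,Δ^{(L^m)}B⟩ ≤ Crate(d)·L^{−2m}·⟨∂₁B,∂₁B⟩`: the sibling's two-sided limit rate with its sign.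
[folklore] -/
theorem formDk_le_limit (L : ℕ) (hL : 2 ≤ L) (B : Tor M × Fin d → ℂ) :
    ∃ Finf : ℝ, Tendsto (fun k => formDk (L ^ k) M B) atTop (𝓝 Finf)
      ∧ (∀ k, formDk (L ^ k) M B ≤ Finf)
      ∧ ∀ k, Finf - formDk (L ^ k) M B ≤ Crate d * ((L : ℝ) ^ k)⁻¹ ^ 2 * d1Sq M B := by
  obtain ⟨Finf, ht, hb⟩ := B5ActionRate166.formDk_limit M L hL B
  have hmono := formDk_pow_monotone M L (by omega) B
  refine ⟨Finf, ht, fun k => hmono.ge_of_tendsto ht k, fun k => ?_⟩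
  have h := hb k
  rw [abs_sub_comm] at h
  exact le_trans (le_abs_self _) h

/-- **THE BOX VARIABLE CONVERGES DOWNWARD TO ITS INFIMUM `y_∞ ≥ γ₀`, AND A FLOOR FOR `y_∞` IS A FLOOR AT EVERY
LEVEL**: for `L ≥ 1`, `p′ ≠ 0`: `y^{(L^m)} → y_∞ := inf_m y^{(L^m)}`, `γ₀ ≤ y_∞ ≤ y^{(L^m)}` for all `m`.
[folklore] -/
theorem xIn_tendsto_iInf (L : ℕ) (hL : 1 ≤ L) (s : Fin d → ℝ) (hs : ∀ ν, |s ν| ≤ π) (ν₀ : Fin d)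
    (hν₀ : s ν₀ ≠ 0) (κ : Fin d) :
    Tendsto (fun m => xIn (L ^ m) s κ) atTop (𝓝 (⨅ m, xIn (L ^ m) s κ))
      ∧ gam0 d ≤ ⨅ m, xIn (L ^ m) s κ
      ∧ ∀ m, ⨅ m, xIn (L ^ m) s κ ≤ xIn (L ^ m) s κ := by
  have hlo : ∀ m, gam0 d ≤ xIn (L ^ m) s κ := fun m => by
    haveI : NeZero (L ^ m) := ⟨pow_ne_zero m (Nat.one_le_iff_ne_zero.mp hL)⟩
    exact (xIn_mem_box (L ^ m) (Nat.one_le_iff_ne_zero.mpr (pow_ne_zero m (Nat.one_le_iff_ne_zero.mp hL))) s hs ν₀ hν₀ κ).1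
  have hbdd : BddBelow (Set.range fun m => xIn (L ^ m) s κ) := by
    refine ⟨gam0 d, ?_⟩
    rintro _ ⟨m, rfl⟩
    exact hlo m
  exact ⟨tendsto_atTop_ciInf (xIn_pow_antitone L hL s hs ν₀ hν₀ κ) hbdd, le_ciInf hlo,
    fun m => ciInf_le hbdd m⟩

/-- **FLOOR TRANSFER FROM THE LIMIT**: if `y ≤ inf_m y_λ^{(L^m)}(p′)` for all `λ` (one certified floor for ONE
function of `p′`), then `y ≤ y_λ^{(L^m)}(p′)` at every level `m` — the floor hypothesis of every
`LogCloseRate` / `RateCertificate` socket at all levels at once. [folklore] -/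
theorem floor_of_iInf_floor (L : ℕ) (hL : 1 ≤ L) (s : Fin d → ℝ) (hs : ∀ ν, |s ν| ≤ π) (ν₀ : Fin d)
    (hν₀ : s ν₀ ≠ 0) {y : ℝ} (hfl : ∀ κ, y ≤ ⨅ m, xIn (L ^ m) s κ) (m : ℕ) (κ : Fin d) :
    y ≤ xIn (L ^ m) s κ :=
  le_trans (hfl κ) ((xIn_tendsto_iInf L hL s hs ν₀ hν₀ κ).2.2 m)

end Limit

end Literature.MathematicalPhysics.QuantumFieldTheory.Balaban1983to89.Beta.MonotoneScales

end
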